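import Literature.Analysis.FluidPDE.TaoEnstrophyExteriorOfNonlinearEstimate
import Literature.Analysis.FluidPDE.TaoY6WhitneySum
import HarnessLib

/-!
# Tao (2011/2013), Thm. 10.1 (Enstrophy localisation) in the exterior form of Remark 10.6 is a
# theorem

One-line bookkeeping file (kept separate so that `TaoY6WhitneySum.lean` does not import the
discharge of Prop. 9.1): the named fact `tao2011_enstrophyLocalisation_exterior`
(`TaoEnstrophyLocalisation.lean`; T. Tao, *Localisation and compactness properties of the
Navier–Stokes global regularity problem*, arXiv:1108.1165, Thm. 10.1 = arXiv Thm. 59 with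
Remark 10.6 = arXiv Rem. 64, every viscosity `ν > 0`, `f = 0`) follows from the tree's reduction
`tao2011_enstrophyLocalisation_exterior_of_nonlinearEstimate`
(`TaoEnstrophyExteriorOfNonlinearEstimate.lean`: Lemma 8.1, Prop. 9.1 and the §10 assembly are
theorems) and the discharge of the `Y₆` estimate `tao2011_nonlinearEstimate_holds`
(`TaoY6WhitneySum.lean`). No statement is modified and no definition is introduced.

## References

* T. Tao, *Localisation and compactness properties of the Navier–Stokes global regularity
  problem*, Anal. PDE 6 (2013) 25–107 = arXiv:1108.1165 (`Tao2011`), Thm. 10.1, Remark 10.6, §10.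
-/

namespace Literature.Analysis.FluidPDE

/-- **Tao 2011, Thm. 10.1 (Enstrophy localisation), exterior form of Remark 10.6 — a theorem**
(discharge of the named fact `tao2011_enstrophyLocalisation_exterior`). [cite: Tao2011, Thm. 10.1 + Remark 10.6] -/
theorem tao2011_enstrophyLocalisation_exterior_holds : tao2011_enstrophyLocalisation_exterior :=
  tao2011_enstrophyLocalisation_exterior_of_nonlinearEstimate tao2011_nonlinearEstimate_holds

end Literature.Analysis.FluidPDE
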